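import Literature.AlgebraicGeometry.Hu2025.Statements.S04ModelV.R103aModelR
import Literature.AlgebraicGeometry.Hu2025.Statements.S04ModelV.R103bDescendants
import HarnessLib


/-!
# Hu 2025 (arXiv:2507.21400v1), §4.2.3–§4.3 (chunks p0023 l.69 – p0028 l.158; PDF pp.51–65) — 𝔟-REDUCIBILITY, `deg_ϱ`,
# square-freeness / `φ`-square-freeness, the 𝔯𝔟-BINOMIALS `𝓑^𝔯𝔟_{[k]}` and Prop. 4.33: PARTITION-HU row 104, file a
# (`S04ModelV/R104aBinomialClasses.lean`; decls `Def4_15`, `Def4_19`, `rbBinomials`, `Def4_32`, `Prop4_33` and their definientia).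
# STATEMENTS-FIRST typing (rung M-Hu of LADDER-RESOLUTION, D-0089); typer res-type-044 (body of record v2 5409381ba329bea9,
# PARTITION-HU v1.15 §3c.1), on top of row 103's `R103aModelR` (I-R) and `R103bDescendants`.

**Status of the source (D-0012): UNREFEREED PREPRINT UNDER ADJUDICATION.** Nothing from the preprint is asserted:
definitions are REAL Lean definitions, printed claims are `def … : Prop` CANDIDATES `[claim: Hu2025, status:
under-review]`. No proofs, no `sorry`, no `instance`, no notation. NUMBERING (PARTITION-HU §0 CUSTODY ERRATUM): in §4
the PRINTED (PDF) number = chunk number + 1 after Def. 4.1; decl names follow the PDF, docstrings carry both. PDF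
equation numbers read on the PDF page text (pdfTeX text layer of `lit/res-lit-6/hu25/hu2025_2507.21400v1.pdf`).
HONEST CEILING (PARTITION-HU header): Part I as printed claims resolution of singularity TYPES; the summit-type claim
rests on the UNPOSTED Part II. AI typing/adjudication is weaker than expert review.

## Scope of this file inside row 104 (PARTITION-HU v1.6 row 104: «Lem 4.16–Cor 4.31, Lem 4.36, Lem 4.38–Ex 4.41 (PDF
nos.), Examples = OPTIONAL (index only unless a definiens needs them)»; §2: the §4.2–4.4 lemmas on `ker^{mh} φ` beyond the
definitions the chart equations use are NOT load-bearing for the four joints — G-H5). Typed: Def. 4.15 (+ the in-text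
sentence p.51 on common factors), `deg_ϱ` (p.53), square-free (p.54), Def. 4.19, Def. 4.32, Prop. 4.33. Index only
(not typed): Lem. 4.16, Ex. 4.17, Lem. 4.18, Ex. 4.20, Lem. 4.21, Cor. 4.22, Ex. 4.23, Lem. 4.24–4.27, Cor. 4.28, Rem.
4.29/4.30, Cor. 4.31, Ex. 4.34/4.35 (PDF numbers).

## Carriers = I-R's (row 103): `{k} [CommRing k] {σ T 𝔗}`, `rel`, `mono`, `ModelRing σ T k` (= `R`), `varphi mono` (= `φ`),
`kerMH rel mono Φ` (= `ker^mh φ_Φ`; printed `Φ = 𝓕_{[k]}`), `IsMultiHomogeneous`, `IsRhoLinear`, `monoR`, `wpBinomial`,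
`IsWpIrreducible` (Def. 4.7 on exponent pairs); row 103 file b (`R103bDescendants`): `IsParentOf`,
`IsPartialParentOf`, `IsRootPolynomial`, `HasNoCommonFactor`. Prop. 4.33 reads two more data off the primary relations
(rows 101/102 through row 103's instantiation; the same names as res-type-079's I-GOV): `head : 𝔗 → T` (the leading term
`s_F` of `F̄`, so `x_{(m,u_F)} = x_{head F}` and `x̄_{head F} = x_{u_F}`) and `rk : 𝔗 → ℕ` (the rank of `F̄_{m,u}`, Def.
3.12 / I-PL `rkPrimary`: `0` for `u_F = (iuv)`, `1` for `u_F = (abc)`, `3 < a < b < c`).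
## Rendering choices (for the lanes; none takes a side)
* Binomials `m − m'` are carried by EXPONENT PAIRS `(a, a')` as in I-R's Def. 4.7 (`f = monomial a 1 − monomial a' 1`);
  divisibility of monomials = `≤` of exponent vectors; «not constant» = non-zero exponent vector.
* Def. 4.15's «`m_1 − m_1', m_2 − m_2' ∈ ker φ_{[k]}`» is `φ(·) = 0` (PDF p.46 l.22–23: «`f ∈ ker φ_{[k]} ⟺ f ∈ ker φ`»; factors of
  a monomial of `R_{[k]}` lie in `R_{[k]}`), so 𝔟-reducibility does not depend on `[k]`.
* `deg_ϱ`, square-freeness and `φ`-square-freeness are computed on exponent vectors (`degRho`, `phiExp`).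
-/

noncomputable section

namespace Literature.AlgebraicGeometry.Hu2025.Statements.S04ModelV

open MvPolynomial

section BinomialClasses

universe u v w x

variable {k : Type u} [CommRing k] {σ : Type v} {T : Type w} {𝔗 : Type x}
variable (rel : T → 𝔗) (mono : T → (σ →₀ ℕ))

/-! ## §4.2.3 Def. 4.15 ‹chunk Definition 4.14› (chunk p0023 l.69–101; PDF p.51; display (4.11)) -/

/-- The condition Def. 4.15 puts on each FACTOR binomial `m_i − m_i'` of a 𝔟-reducible decomposition (chunk p0023
l.80–85; PDF p.51): «`m_i − m_i' ∈ ker φ_{[k]}`» and «is a descendant or a partial descendant of a multi-homogenous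
binomial» — on the exponent pair `(b, b')`: `φ(monomial b 1 − monomial b' 1) = 0` and SOME multi-homogeneous binomial
`monomial c 1 − monomial c' 1` is a parent (`IsParentOf`, Def. 4.11) or a partial parent (`IsPartialParentOf`, Def.
4.12) of it. Plumbing for `IsFbReducibleDecomp`. [claim: Hu2025, status: under-review]
STATUS: candidate statement under adjudication (D-0012/D-0089); not asserted. -/
def IsFbFactor [DecidableEq 𝔗] (b b' : σ ⊕ T →₀ ℕ) : Prop :=
  varphi (k := k) mono ((monomial b (1 : k) : ModelRing σ T k) - monomial b' 1) = 0 ∧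
    ∃ c c' : σ ⊕ T →₀ ℕ,
      IsMultiHomogeneous (k := k) (σ := σ) rel ((monomial c (1 : k) : ModelRing σ T k) - monomial c' 1) ∧
        (IsParentOf (k := k) rel mono ((monomial c (1 : k) : ModelRing σ T k) - monomial c' 1)
            ((monomial b (1 : k) : ModelRing σ T k) - monomial b' 1) ∨
          IsPartialParentOf (k := k) rel mono ((monomial c (1 : k) : ModelRing σ T k) - monomial c' 1)
            ((monomial b (1 : k) : ModelRing σ T k) - monomial b' 1))

/-- **Hu 2025, Def. 4.15 ‹chunk Definition 4.14›, a 𝔟-reducible decomposition (4.11)** (chunk p0023 l.71–91; PDF p.51),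
verbatim: «Let `f = m − m' ∈ ker^{mh} φ_{[k]}`. We say `f` is 𝔟-reducible if there exists a decomposition (4.11) `m = m_1
m_2`, `m' = m_1' m_2'` such that all the monomials in the expression are not constant and `m_1 − m_1', m_2 − m_2' ∈ ker
φ_{[k]}` and every of `m_1 − m_1'` and `m_2 − m_2'` is a descendant or a partial descendant of a multi-homogenous
binomial. Here, when one of the two above binomials in the display is zero, say, `m_2 − m_2' = 0`, then we have `f =
m_2 (m_1 − m_1')`, as a special case. We call (4.11) a 𝔟-reducible decomposition of `f`.» — on exponent vectors: `a =
a_1 + a_2`, `a' = a_1' + a_2'`, all four non-zero («not constant»), and both factor pairs satisfy `IsFbFactor`. The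
printed special case «`m_2 − m_2' = 0` … `f = m_2 (m_1 − m_1')`» is the instance `a₂ = a₂'` of THIS predicate, not a separate
disjunct: the zero binomial `monomial a₂ 1 − monomial a₂ 1 = 0` satisfies `IsFbFactor` because `φ(0) = 0`, `0` is
multi-homogeneous in I-R's sense (weighted-homogeneous of every block degree) and `IsParentOf` (Def. 4.11) is reflexive, so
it is its own multi-homogeneous parent (lane-B pre-read note res-ref-b11 2026-08-27T07:01:08Z (104); recorded, nothing
decided). The hypothesis «`f ∈ ker^{mh} φ_{[k]}`» is the consumer's. [claim: Hu2025, status: under-review]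
STATUS: candidate statement under adjudication (D-0012/D-0089); not asserted. -/
def IsFbReducibleDecomp [DecidableEq 𝔗] (a a' a₁ a₂ a₁' a₂' : σ ⊕ T →₀ ℕ) : Prop :=
  a = a₁ + a₂ ∧ a' = a₁' + a₂' ∧ a₁ ≠ 0 ∧ a₂ ≠ 0 ∧ a₁' ≠ 0 ∧ a₂' ≠ 0 ∧
    IsFbFactor (k := k) rel mono a₁ a₁' ∧ IsFbFactor (k := k) rel mono a₂ a₂'

/-- **Hu 2025, Def. 4.15 ‹4.14›, 𝔟-reducible** (chunk p0023 l.71–91; PDF p.51): the binomial with exponent pair `(a, a')`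
admits a 𝔟-reducible decomposition (4.11). [claim: Hu2025, status: under-review]
STATUS: candidate statement under adjudication (D-0012/D-0089); not asserted. -/
def IsFbReducible [DecidableEq 𝔗] (a a' : σ ⊕ T →₀ ℕ) : Prop :=
  ∃ a₁ a₂ a₁' a₂' : σ ⊕ T →₀ ℕ, IsFbReducibleDecomp (k := k) rel mono a a' a₁ a₂ a₁' a₂'

/-- **Hu 2025, Def. 4.15 ‹4.14›, 𝔟-irreducible** (chunk p0023 l.93; PDF p.51), verbatim: «We say `f` is 𝔟-irreducible if
it is not 𝔟-reducible.» [claim: Hu2025, status: under-review]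
STATUS: candidate statement under adjudication (D-0012/D-0089); not asserted. -/
def IsFbIrreducible [DecidableEq 𝔗] (a a' : σ ⊕ T →₀ ℕ) : Prop :=
  ¬ IsFbReducible (k := k) rel mono a a'

/-- **Hu 2025, Def. 4.15** — numbered alias of `IsFbReducible` (PDF Def. 4.15 = chunk «Definition 4.14», p0023 l.71–93;
p.51). [claim: Hu2025, status: under-review]
STATUS: candidate statement under adjudication (D-0012/D-0089); not asserted. -/
abbrev Def4_15 [DecidableEq 𝔗] (a a' : σ ⊕ T →₀ ℕ) : Prop := IsFbReducible (k := k) rel mono a a'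

/-- **Hu 2025, in-text sentence after Def. 4.15** (chunk p0023 l.95–97; PDF p.51), verbatim: «By definition, `m − m'`
is 𝔟-irreducible, then `m` and `m'` do not have any (non-constant) common factor.» — typed claim for non-zero binomials
of `ker^{mh} φ_Φ` (the scope of Def. 4.15). [claim: Hu2025, status: under-review]
STATUS: candidate statement under adjudication (D-0012/D-0089); not asserted. -/
def C23L95 [DecidableEq 𝔗] (Φ : Set 𝔗) : Prop :=
  ∀ a a' : σ ⊕ T →₀ ℕ, a ≠ a' →
    ((monomial a (1 : k) : ModelRing σ T k) - monomial a' 1) ∈ kerMH (k := k) rel mono Φ →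
      IsFbIrreducible (k := k) rel mono a a' → HasNoCommonFactor (σ := σ) (T := T) a a'

/-! ## §4.2.4 `deg_ϱ`, square-free, Def. 4.19 ‹chunk Definition 4.18› (chunk p0024 l.29–107; PDF pp.53–54) -/

/-- **Hu 2025, `deg_ϱ`** (chunk p0024 l.31–36; PDF p.53), verbatim: «For any `m − m' ∈ ker^{mh} φ_{[k]}`, we define
`deg_ϱ(m − m')` to be the total degree of `m` (equivalently, `m'`) in ϱ-variables of `R_{[k]}`.» — on one exponent
vector: the sum of the exponents of the ϱ-variables (right summand). [claim: Hu2025, status: under-review]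
STATUS: candidate statement under adjudication (D-0012/D-0089); not asserted. -/
def degRho (a : σ ⊕ T →₀ ℕ) : ℕ :=
  a.sum fun (i : σ ⊕ T) (n : ℕ) => Sum.elim (fun _ : σ => 0) (fun _ : T => n) i

/-- **Hu 2025, square-free** (chunk p0024 l.86–98; PDF p.54), verbatim: «A monomial `𝐦` is square-free if `x^2` does not
divide `𝐦` for every coordinate variable `x` in the affine space. A polynomial is square-free if all of its monomials
are square-free.» — for a polynomial in any set of variables `ι`: every exponent of every monomial in its support is
`≤ 1`. [claim: Hu2025, status: under-review]
STATUS: candidate statement under adjudication (D-0012/D-0089); not asserted. -/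
def IsSquareFree {ι : Type v} (f : MvPolynomial ι k) : Prop :=
  ∀ a ∈ f.support, ∀ i : ι, a i ≤ 1

/-- The exponent vector of `φ(m) ∈ R_0` for a monomial `m` of `R` with exponent vector `a` (plumbing for Def. 4.19): the
ϖ-exponents of `a` plus, for every ϱ-variable `x_t`, `a(x_t)` copies of the chart monomial `mono t = x̄_t` (so `φ
(monomial a 1) = monomial (phiExp mono a) 1`, by (4.7)). [claim: Hu2025, status: under-review]
STATUS: candidate statement under adjudication (D-0012/D-0089); not asserted. -/
def phiExp (a : σ ⊕ T →₀ ℕ) : σ →₀ ℕ :=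
  a.sum fun (i : σ ⊕ T) (n : ℕ) => n • Sum.elim (fun s : σ => Finsupp.single s 1) mono i

/-- **Hu 2025, Def. 4.19 ‹chunk Definition 4.18›, `φ`-square-free** (chunk p0024 l.100–102; PDF p.54), verbatim: «A
polynomial `f` of `R` is called `φ`-square-free if for any monomial summand `m` of `f`, `φ(m)` is square-free.» The
adjective «ϱ-linear» recalled next (chunk p0024 l.104–107 «Recall that a polynomial `f ∈ R_{[k]} (⊂ R)` is ϱ-linear if
it is linear in the homogeneous coordinates of `ℙ_F` for any `F̄ ∈ 𝓕` whenever some homogeneous coordinate of `ℙ_F`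
divides a monomial summand of `f`») is I-R's `IsRhoLinear` (Def. 4.3), not re-typed. [claim: Hu2025, status:
under-review]
STATUS: candidate statement under adjudication (D-0012/D-0089); not asserted. -/
def IsPhiSquareFree (f : ModelRing σ T k) : Prop :=
  ∀ a ∈ f.support, ∀ s : σ, phiExp mono a s ≤ 1

/-- **Hu 2025, Def. 4.19** — numbered alias of `IsPhiSquareFree` (PDF Def. 4.19 = chunk «Definition 4.18», p0024
l.100–102; p.54). [claim: Hu2025, status: under-review]
STATUS: candidate statement under adjudication (D-0012/D-0089); not asserted. -/
abbrev Def4_19 (f : ModelRing σ T k) : Prop := IsPhiSquareFree (k := k) mono f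

/-! ## §4.3 Def. 4.32 ‹chunk Definition 4.31› and Prop. 4.33 ‹chunk Proposition 4.32› (chunk p0028 l.58–96; PDF p.64) -/

/-- **Hu 2025, Def. 4.32 ‹chunk Definition 4.31›, 𝔯𝔟-binomial** (chunk p0028 l.58–61; PDF p.64), verbatim: «A
𝔟-irreducible root binomial `m − m'` that is also ℘-irreducible is called an 𝔯𝔟-binomial. We let `𝓑^𝔯𝔟_{[k]}` be the set
of all 𝔯𝔟-binomials of `ker^{mh} φ_{[k]}`.» — on the exponent pair `(a, a')`, for the relations `Φ` in play (printed `Φ =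
𝓕_{[k]}`): the binomial is a NON-ZERO (`a ≠ a'`, the scope of Def. 4.7/4.15) member of `ker^{mh} φ_Φ`, a root polynomial
(Def. 4.11), 𝔟-irreducible (Def. 4.15) and ℘-irreducible (Def. 4.7, I-R's `IsWpIrreducible`).
[claim: Hu2025, status: under-review]
STATUS: candidate statement under adjudication (D-0012/D-0089); not asserted. -/
def IsRbBinomial [DecidableEq 𝔗] (Φ : Set 𝔗) (a a' : σ ⊕ T →₀ ℕ) : Prop :=
  a ≠ a' ∧ ((monomial a (1 : k) : ModelRing σ T k) - monomial a' 1) ∈ kerMH (k := k) rel mono Φ ∧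
    IsRootPolynomial (k := k) rel mono ((monomial a (1 : k) : ModelRing σ T k) - monomial a' 1) ∧
      IsFbIrreducible (k := k) rel mono a a' ∧ IsWpIrreducible (k := k) rel mono Φ a a'

/-- **Hu 2025, Def. 4.32 ‹4.31›, the set `𝓑^𝔯𝔟_{[k]}`** (chunk p0028 l.60–61; PDF p.64): «the set of all 𝔯𝔟-binomials of
`ker^{mh} φ_{[k]}`» — as a subset of `R` (PARTITION name `rbBinomial`(s)). [claim: Hu2025, status: under-review]
STATUS: candidate statement under adjudication (D-0012/D-0089); not asserted. -/
def rbBinomials [DecidableEq 𝔗] (Φ : Set 𝔗) : Set (ModelRing σ T k) :=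
  {f | ∃ a a' : σ ⊕ T →₀ ℕ, f = (monomial a (1 : k) : ModelRing σ T k) - monomial a' 1 ∧
    IsRbBinomial (k := k) rel mono Φ a a'}

/-- **Hu 2025, Def. 4.32** — numbered alias of `rbBinomials` (PDF Def. 4.32 = chunk «Definition 4.31», p0028 l.58–61;
p.64). [claim: Hu2025, status: under-review]
STATUS: candidate statement under adjudication (D-0012/D-0089); not asserted. -/
abbrev Def4_32 [DecidableEq 𝔗] (Φ : Set 𝔗) : Set (ModelRing σ T k) := rbBinomials (k := k) rel mono Φ

/-- **Hu 2025, Prop. 4.33 ‹chunk Proposition 4.32›** (chunk p0028 l.68–78; PDF p.64), verbatim: «Let `f = m − m' ∈ ker^{mh}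
φ` be an 𝔯𝔟-binomial, then we have • `f` is ϱ-linear and `φ`-square-free. • `x_{abc} ∤ m m'`, `x_{(123,abc)} ∤ m m'` for all
`3 < a < b < c`. • `x_{(123,iuv)} x_{iuv} ∤ m m'` for all `i ∈ [3]`.» — for the relations `Φ` in play (printed: `φ`, i.e.
`Φ = univ`); the rank-1 indices `(abc)` and rank-0 indices `(iuv)` are the `u_F` of the primary relations `F̄ = F̄_{m,u_F}`
with `rk F = 1`, resp. `0` (every `u ∈ 𝕀_{3,n}` with `|u ∩ m| ≤ 1` indexes a primary relation, §3.3), `x_{u_F} = x̄_{head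
F}` (exponent vector `monoR mono (head F)`) and `x_{(123,u_F)} = x_{head F}`; «`x ∤ m m'`» = the exponent vector of `x` is
not `≤ a + a'`. [claim: Hu2025, status: under-review]
STATUS: candidate statement under adjudication (D-0012/D-0089); not asserted. -/
def Prop4_33 [DecidableEq 𝔗] (head : 𝔗 → T) (rk : 𝔗 → ℕ) (Φ : Set 𝔗) : Prop :=
  ∀ a a' : σ ⊕ T →₀ ℕ, IsRbBinomial (k := k) rel mono Φ a a' →
    (IsRhoLinear (k := k) (σ := σ) rel ((monomial a (1 : k) : ModelRing σ T k) - monomial a' 1) ∧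
      IsPhiSquareFree (k := k) mono ((monomial a (1 : k) : ModelRing σ T k) - monomial a' 1)) ∧
    (∀ F : 𝔗, rk F = 1 →
      ¬ monoR mono (head F) ≤ a + a' ∧ ¬ Finsupp.single (Sum.inr (head F)) 1 ≤ a + a') ∧
    (∀ F : 𝔗, rk F = 0 → ¬ Finsupp.single (Sum.inr (head F)) 1 + monoR mono (head F) ≤ a + a')

end BinomialClasses

end Literature.AlgebraicGeometry.Hu2025.Statements.S04ModelV

end
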